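import Summits.ValiantsHypothesis.ValiantsHypothesis.Theorems.DivisionGapShadowBirkhoffOfPolytropePencil

/-!
# `DivisionGap.ShadowBirkhoff` (stmt-ValiantsHypothesis-5069) via the line `polytrope-kr-planar-dimers` — skeleton, v3

Registered crux skeleton of the line (leads prover-line-stmt-ValiantsHypothesis-5069-a1-0, -c1-0, now -c2-0).  State:
the three transfer stubs are landed theorems with literally the registered signatures (`stub_faceShadow` p96561,
`stub_dominoFace` p96839, `stub_heightPolytrope` p100612), and the whole composition is the landed conditional theorem
`shadowBirkhoff_of_polytropePencil` (`Theorems/DivisionGapShadowBirkhoffOfPolytropePencil.lean`, p105889): the engine,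
stated verbatim as a hypothesis, implies the crux by name.  So this file is reduced to the ONE open stub — the engine
`stub_polytropePencil` — and a one-line closed term.

* `stub_polytropePencil` — THE ENGINE (open; the only `sorry`): for every `c` and all large `m` some pencil `w₁ + t·w₂` of
  lattice-point weights on the `2m × 2m` board has more than `2^((log₂ 2m + c)^c)` height functions that are its unique
  maximiser at some parameter (= super-quasi-polynomially many break points of a parametric max-weight height function =
  of a parametric-cost unit-capacity min-cost flow on the planar cell graph; see the line card
  `Cruxes/ShadowBirkhoff/Lines/polytrope-kr-planar-dimers.md` and the leads' analyses `stub4-analysis-c1.md`,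
  `stub4-analysis-c2.md` on the item: open in print in both directions).
* `ShadowBirkhoff_closed` — the crux BY NAME from the stub (audit class `proof-of-item` modulo the one `sorry`); when the
  engine lands this is the file to propose `--workitem stmt-ValiantsHypothesis-5069`.

Disproof used: `Cruxes/ShadowBirkhoff/Disproof.lean` has no `_false_without_` theorem (the crux has no hypothesis); its
negative lemmas (values lemma, Minkowski additivity, Gusfield cap, row-set entropy) constrain the witness `w` of the engine
(real weights of super-polylogarithmic bit length, `w₂` of mixed sign, many scales).
-/

noncomputable section

set_option linter.dupNamespace false

namespace Summit.ValiantsHypothesis.ValiantsHypothesis.Theorems.DivisionGapShadowBirkhoff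

/-- **STUB 4 · `stub_polytropePencil`** — THE ENGINE, open (registered signature): parametric max-weight height functions
of the `2m × 2m` board have more than `2^((log₂ 2m + c)^c)` break points (unique maximisers along one pencil of
lattice-point weights) for every `c` and all large `m`.  HARDEST stub, size X: no lower bound beyond the expected
`m^{Ω(log m)}` floor is known for any planar form, no upper bound below the separator ceiling `2^{O(m)}`; a kill is a
quasi-polynomial bound on the number of distinct optimal height profiles met on a separator column along one pencil.
Certification device for a construction: a dual flow `f ≥ 0` on the constraint rows with divergence `w₁ + t_k w₂` at
interior points, complementary to `g_k`, whose support connects every lattice point to the boundary, proves `g_k` is the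
unique maximiser at `t_k`. -/
theorem stub_polytropePencil :
    ∀ c : ℕ, ∃ m₀ : ℕ, ∀ m ≥ m₀, ∃ w : LatticePt m → ℝ × ℝ,
      2 ^ ((Nat.log 2 (2 * m) + c) ^ c) < (uniqueMaximisers m w).ncard := by
  sorry

/-- **`ShadowBirkhoff_closed`** — the crux by name from the engine stub through the landed bridge
`shadowBirkhoff_of_polytropePencil` (which composes the three landed transfer stubs). -/
theorem ShadowBirkhoff_closed : Summit.ValiantsHypothesis.ValiantsHypothesis.Theses.DivisionGap.ShadowBirkhoff :=
  shadowBirkhoff_of_polytropePencil stub_polytropePencil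

end Summit.ValiantsHypothesis.ValiantsHypothesis.Theorems.DivisionGapShadowBirkhoff

end
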